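import Literature.MathematicalPhysics.QuantumFieldTheory.Balaban1983to89.B9Thm31GpDecayOfCoerciveZd
import Literature.MathematicalPhysics.QuantumFieldTheory.Balaban1983to89.B9Thm31CoercivePrimeCompactZd

/-!
# `Balaban1983to89.B9Thm31GpDecayPlaqClosedZd` — [Balaban1985BackgroundPropagators] Thm 3.1 p. 397, (3.42) n = 0 SHAPE FOR THE GENUINE `G′(U₀)` OF THE `ℤᵈ`
# FRAME WITH NO DISPLAYED HYPOTHESIS: at every finite `Ω₀` and for the CLOSED small-field class «every plaquette variable within `β` of `1`», `β` below the
# averaging window, there are `C, κ > 0` (member-dependent) with `|(G′(U₀)δ_y w)(x)|_τ ≤ C·e^{−κ|x−y|_∞}·|w|_τ` for EVERY unitary `U₀` of the class —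
# dag-n06-w4 g4's compactness constant `c′` (`B9Thm31CoercivePrimeCompactZd`) fed into this seat's reduction (`B9Thm31GpDecayOfCoerciveZd`)

statement-level skeleton of published theorems with citation tags; proofs where landed; nothing here is a claim about the
Yang–Mills mass gap

`[Balaban1985BackgroundPropagators]` ("B9", CMP **99** (1985) 389–434) Thm 3.1 p. 397: *«there exist positive constants … such that … uniformly in U, Ω_j»* and
(3.42) p. 397 *«|(G′(U)λ)(x)| ≦ B₀(Lʲη)²e^{−δ₀d(y,y′)}|λ| for x ∈ Δ(y), y ∈ Λ_j, supp λ ⊂ Δ(y′)»*; Thm 3.11 p. 416; [Balaban1985RegularSpaces] (1.7) p. 77 (the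
small-field class); [Balaban1985Averaging] Prop. 2 p. 26.  HERE the n = 0 entry's SHAPE is closed at a finite member with MEMBER-DEPENDENT `C, κ` (compactness),
NOT print's uniform `B₀(Lʲη)²`, `δ₀` — the honest per-member object evidence for the genuine `G′`.

CITATION HEADER (lean-in-tree rule).  Cell `pub-ymgap` (YM Track A, HUMAN RULING D-0062 ∕ D-0149 width push), DAG node N06 = [B9], width seat
`pub-ymgap-dag-n06-w2` (g4), CLAIM-4.  Inputs BY NAME: `B9Thm31GpDecayOfCoerciveZd.fnorm_GpZd_single_le_exp_of_coercive_of_reg17UnivP` (this seat),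
`B9Thm31CoercivePrimeCompactZd.exists_coercive_formE_deltaPrimeADom_plaqClosed ∕ reg17Univ_of_forall_plaqF_le ∕ one_mem_plaqClosed` (dag-n06-w4 g4).
Nothing restated.

WHAT IS PROVED (kernel, 0 sorry, 0 def).
* §1 `exists_rate_of_window` — the elementary window: for `c > 0`, `a₀, N, r ≥ 0` there is `κ > 0` with `a₀N(e^{κr} − 1) ≤ c∕2` (`e^{x} − 1 ≤ 2x` on `[0,1]`).
* §2 ★★★ `exists_fnorm_GpZd_single_le_exp_plaqClosed` — `0 < d`, `2 ≤ L`, `η ≠ 0`, `a ≥ 0`, finite `Ω₀ = s`, faithful Hermitian tracial `τ` on the finite-dimensional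
  fibre, `β < (α_Q∕L²)·L^{−2m}`: `∃ C κ > 0, ∀ U₀` unitary with `‖U₀(∂p) − 1‖ ≤ β` for all plaquettes, `∀ y ∈ s, ∀ w, ∀ x`,
  `|(G′(U₀)δ_y w)(x)|_τ ≤ C·e^{−κ|x−y|_∞}·|w|_τ`; `…_one` (A6: the flat background is in the class, so the bound is inhabited).

HONEST SCOPE.  Per member; `C, κ` come from a compactness constant and are NOT quantitative; nothing uniform in `Ω₀`, `m`, `η`; nothing of Thm 3.3 ∕ the
gradient and Hölder entries.  Count-neutral; N05 ∕ N06 NOT discharged; K1⁸ `stmt-QuantumFields-26907` NOT closed; one finite `𝕋⁴` programme at fixed `ε`,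
Bałaban as printed; R4 closes only the conditional finite-`𝕋⁴` rung `BalabanLadder.UV` — nothing continuum ∕ ℝ⁴ ∕ OS ∕ mass gap ∕ Clay.  Unit
`pub-ymgap-dag-n06-w2` (g4), 2026-08-28.
-/

noncomputable section

open scoped BigOperators

namespace Literature.MathematicalPhysics.QuantumFieldTheory.Balaban1983to89.B9Thm31GpDecayPlaqClosedZd

open B7Prop2Explicit (unitaryUnits)
open B8Ineq132 (plaqF)
open B9Eq321LandauProjectionZd (suppSub)
open B9Eq324DeltaPrimeAZd (single restrictSite GpZd)
open B9Eq316AveragingTransposeZd (alphaQ)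
open B9Eq342CombesThomasFormZd (fnorm fnorm_nonneg)
open B9Thm31GpDecayOfCoerciveZd (fnorm_GpZd_single_le_exp_of_coercive_of_reg17UnivP)
open B9Thm31CoercivePrimeCompactZd (exists_coercive_formE_deltaPrimeADom_plaqClosed reg17Univ_of_forall_plaqF_le)
open LatticeNorms (linfDist)

export B7Prop1Explicit (Site)

/-! ## §1  The elementary rate window -/

/-- **THE RATE WINDOW**: for `c > 0` and `a₀, N, r ≥ 0` there is `κ > 0` with `a₀·N·(e^{κr} − 1) ≤ c∕2` (take `κr ≤ 1` and use `e^{x} − 1 ≤ 2x`). [folklore]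
[cite: Balaban1988RG2Cluster, (2.7) p.13 (bookkeeping of the conjugation window)] -/
theorem exists_rate_of_window {c a₀ N r : ℝ} (hc : 0 < c) (ha₀ : 0 ≤ a₀) (hN : 0 ≤ N) (hr : 0 ≤ r) :
    ∃ κ : ℝ, 0 < κ ∧ a₀ * N * (Real.exp (κ * r) - 1) ≤ c / 2 := by
  -- `κ := min (1∕(r+1)) (c ∕ (4(a₀N+1)(r+1)))`
  set D : ℝ := 4 * (a₀ * N + 1) * (r + 1) with hD
  have hD0 : 0 < D := by rw [hD]; positivity
  refine ⟨min (1 / (r + 1)) (c / D), lt_min (by positivity) (div_pos hc hD0), ?_⟩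
  set κ := min (1 / (r + 1)) (c / D) with hκ
  have hκ0 : 0 ≤ κ := (lt_min (by positivity : (0 : ℝ) < 1 / (r + 1)) (div_pos hc hD0)).le
  have hκr : κ * r ≤ 1 := by
    have h1 : κ ≤ 1 / (r + 1) := min_le_left _ _
    have h2 : κ * (r + 1) ≤ 1 := by
      calc κ * (r + 1) ≤ 1 / (r + 1) * (r + 1) := mul_le_mul_of_nonneg_right h1 (by positivity)
        _ = 1 := by field_simp
    nlinarith
  have hκr0 : 0 ≤ κ * r := mul_nonneg hκ0 hr
  have hexp : Real.exp (κ * r) - 1 ≤ 2 * (κ * r) := by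
    have h := Real.abs_exp_sub_one_le (x := κ * r) (by rw [abs_of_nonneg hκr0]; exact hκr)
    rw [abs_of_nonneg hκr0, abs_of_nonneg (by linarith [Real.one_le_exp hκr0])] at h
    exact h
  have hκc : κ ≤ c / D := min_le_right _ _
  have hκD : κ * D ≤ c := by
    calc κ * D ≤ c / D * D := mul_le_mul_of_nonneg_right hκc hD0.le
      _ = c := by field_simp
  calc a₀ * N * (Real.exp (κ * r) - 1) ≤ a₀ * N * (2 * (κ * r)) := mul_le_mul_of_nonneg_left hexp (mul_nonneg ha₀ hN)
    _ ≤ (a₀ * N + 1) * (2 * (κ * (r + 1))) := by nlinarith [mul_nonneg ha₀ hN]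
    _ = κ * D / 2 := by rw [hD]; ring
    _ ≤ c / 2 := by linarith

/-! ## §2  ★★★ Exponential decay of the genuine `G′(U₀)` over the closed small-field class, no displayed hypothesis -/

section Decay

variable {d : ℕ} {𝔸 : Type*} [CStarAlgebra 𝔸] [FiniteDimensional ℝ 𝔸] [Nontrivial 𝔸]
variable (L : ℕ) (η : ℝ) (τ : 𝔸 →ₗ[ℂ] ℂ) (hτp : ∀ a : 𝔸, a ≠ 0 → 0 < (τ (star a * a)).re)
  (hτt : ∀ a b : 𝔸, τ (a * b) = τ (b * a)) (hτs : ∀ a : 𝔸, τ (star a) = starRingEnd ℂ (τ a))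
  (m : ℕ) (a : ℕ → ℝ) (Λ : ℕ → Finset (Site d)) (s : Finset (Site d))

include hτt hτs in
/-- ★★★ **[B9] THM 3.1's (3.42), n = 0 SHAPE, FOR THE GENUINE `G′(U₀) = (Ω₀Δ′_a(U₀)Ω₀)⁻¹` OVER THE CLOSED SMALL-FIELD CLASS — NO DISPLAYED HYPOTHESIS.**
`0 < d`, `2 ≤ L`, `η ≠ 0`, `a ≥ 0`, finite `Ω₀ = s`, faithful Hermitian tracial `τ` on a finite-dimensional fibre, and `β < (α_Q∕L²)·L^{−2m}`.  Then there are
`C > 0` and `κ > 0` such that for EVERY unitary background `U₀` with `‖U₀(∂p) − 1‖ ≤ β` for all plaquettes `p`, every `y ∈ Ω₀`, `w`, and every site `x`: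
`|(G′(U₀)δ_y w)(x)|_τ ≤ C·e^{−κ|x−y|_∞}·|w|_τ`.  (Coercivity: dag-n06-w4 g4 by compactness of the class; range, block bound, ball count and the
Combes–Thomas conjugation: this seat's `B9Thm31GpDecayOfCoerciveZd`; the averaged transporters are unitary on the class by [5] Prop. 2.)
[cite: Balaban1985BackgroundPropagators, Thm 3.1 p.397, (3.42) p.397, (3.24) p.394, Thm 3.11 p.416; Balaban1985RegularSpaces, (1.7) p.77; Balaban1985Averaging, Prop. 2 p.26] -/
theorem exists_fnorm_GpZd_single_le_exp_plaqClosed (hd : 0 < d) (hL : 2 ≤ L) (hη : η ≠ 0) (ha : ∀ j, 0 ≤ a j) {β : ℝ}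
    (hβ : β < alphaQ d L / (L : ℝ) ^ 2 * (((L : ℝ) ^ m)⁻¹) ^ 2) :
    ∃ C : ℝ, 0 < C ∧ ∃ κ : ℝ, 0 < κ ∧ ∀ (U₀ : Site d → Fin d → 𝔸ˣ) (hU : ∀ x κ', U₀ x κ' ∈ unitaryUnits 𝔸),
      (∀ (x : Site d) (μ ν : Fin d), ‖plaqF U₀ μ ν x - 1‖ ≤ β) →
        ∀ y ∈ s, ∀ (w : 𝔸) (x : Site d),
          fnorm τ ((GpZd L U₀ η τ hτp m a Λ s hd hη hτt hτs hU ha (restrictSite s (single y w)) : Site d → 𝔸) x) ≤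
            C * Real.exp (-(κ * (linfDist x y : ℝ))) * fnorm τ w := by
  have hL1 : 1 ≤ L := le_trans one_le_two hL
  obtain ⟨c, hc, hco⟩ := exists_coercive_formE_deltaPrimeADom_plaqClosed τ hτp hτt hτs hd hL hη m ha Λ s hβ
  set a₀ : ℝ := 4 * d * (η⁻¹) ^ 2 + ∑ j ∈ Finset.range (m + 1), a j with ha₀
  have ha₀0 : 0 ≤ a₀ := add_nonneg (by positivity) (Finset.sum_nonneg fun j _ => ha j)
  set N : ℝ := (((2 * L ^ m + 1) ^ d : ℕ) : ℝ) with hN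
  set r : ℝ := ((L ^ m : ℕ) : ℝ) with hr
  obtain ⟨κ, hκ, hwin⟩ := exists_rate_of_window (c := c) (a₀ := a₀) (N := N) (r := r) hc ha₀0 (by positivity) (by positivity)
  have hϱ : a₀ * N * (Real.exp (κ * r) - 1) < c := by linarith
  refine ⟨2 / c, by positivity, κ, hκ, fun U₀ hU hplaq y hy w x => ?_⟩
  have hreg := reg17Univ_of_forall_plaqF_le (𝔸 := 𝔸) hL1 m hβ hplaq
  have key := fnorm_GpZd_single_le_exp_of_coercive_of_reg17UnivP L U₀ η τ hτp m a Λ s hd hη hL hτt hτs hU hreg ha hκ.le (hco U₀ hU hplaq) hϱ hy w x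
  refine key.trans ?_
  -- `e^{−κd}∕(c − ϱ) ≤ (2∕c)·e^{−κd}` since `c − ϱ ≥ c∕2`
  have hcϱ : c / 2 ≤ c - a₀ * N * (Real.exp (κ * r) - 1) := by linarith
  have hden : 0 < c - a₀ * N * (Real.exp (κ * r) - 1) := by linarith
  set E := Real.exp (-(κ * (linfDist x y : ℝ))) with hE
  have hexp : 0 ≤ E := (Real.exp_pos _).le
  have h1 : E / (c - a₀ * N * (Real.exp (κ * r) - 1)) ≤ 2 / c * E := by
    rw [div_le_iff₀ hden]
    have h2 : E ≤ 2 / c * E * (c / 2) := by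
      have : 2 / c * E * (c / 2) = E := by field_simp
      rw [this]
    exact h2.trans (mul_le_mul_of_nonneg_left hcϱ (by positivity))
  exact mul_le_mul_of_nonneg_right h1 (fnorm_nonneg τ w)

include hτt hτs in
/-- **A6 ∕ NON-VACUITY**: for `0 ≤ β` below the window the flat background `U₀ = 1` is in the class, so the decay bound above is inhabited at every member.
[cite: Balaban1985BackgroundPropagators, Thm 3.1 p.397, Thm 3.11 p.416; Balaban1985RegularSpaces, (1.7) p.77] -/
theorem exists_fnorm_GpZd_single_le_exp_one (hd : 0 < d) (hL : 2 ≤ L) (hη : η ≠ 0) (ha : ∀ j, 0 ≤ a j) :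
    ∃ C : ℝ, 0 < C ∧ ∃ κ : ℝ, 0 < κ ∧ ∀ y ∈ s, ∀ (w : 𝔸) (x : Site d),
      fnorm τ ((GpZd L (1 : Site d → Fin d → 𝔸ˣ) η τ hτp m a Λ s hd hη hτt hτs (fun _ _ => (unitaryUnits 𝔸).one_mem) ha
          (restrictSite s (single y w)) : Site d → 𝔸) x) ≤ C * Real.exp (-(κ * (linfDist x y : ℝ))) * fnorm τ w := by
  have hL1 : 1 ≤ L := le_trans one_le_two hL
  have hwin : (0 : ℝ) < alphaQ d L / (L : ℝ) ^ 2 * (((L : ℝ) ^ m)⁻¹) ^ 2 := by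
    have hα := B9Eq316AveragingTransposeZd.alphaQ_pos d hL1
    have hL0 : (0 : ℝ) < L := by exact_mod_cast (lt_of_lt_of_le zero_lt_one hL1)
    positivity
  obtain ⟨C, hC, κ, hκ, h⟩ := exists_fnorm_GpZd_single_le_exp_plaqClosed L η τ hτp hτt hτs m a Λ s hd hL hη ha hwin
  have hone := B9Thm31CoercivePrimeCompactZd.one_mem_plaqClosed (d := d) (𝔸 := 𝔸) (le_refl (0 : ℝ))
  exact ⟨C, hC, κ, hκ, fun y hy w x => h 1 (fun _ _ => (unitaryUnits 𝔸).one_mem) hone.2 y hy w x⟩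

end Decay

end Literature.MathematicalPhysics.QuantumFieldTheory.Balaban1983to89.B9Thm31GpDecayPlaqClosedZd

end
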